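import Summits.ResolutionOfSingularities.ResolutionOfSingularities.Theorems.FrobeniusClosingPatchingRelPerfectDepthPhaseCDetachedCylinder
import HarnessLib

/-!
# Crux `PatchingRelPerfect` (stmt-ResolutionOfSingularities-16161), chain W5.2 — F7(β) (β-AX) PHASE C,
# chart certificate C2′ (general exponent): the COMMON-TRACE POLE `(x) + (x + t ℓ) + (tᵃ m)`, every `a ≥ 1`, any `m`

[OURS · L1 W5.2 · F7(β) (β-AX) Phase C · res-L1-w52-plan-1 NAMING G11-7 (2) (C2′) · res-L1-w52-tri-2 NORMAL FORM 15:33:54Z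
«K = (x) + (x + t·ℓ) + (tᵃ·m), hosts `V(x)`, `V(x + tℓ)` regular and ⋔ E″ = V(t), `m` a monomial in OLD members, `ℓ` a regular
parameter that is not a member coordinate; certify with general exponent a ≥ 1 — nothing reachable is lost»] res-L1-w52-stub-1 g5.
Replaces the role of NO printed item; NOT a statement of the manuscript under review (AI-written, weaker than expert review).
Companion of `…DepthPhaseCLinearTwoPlanePole` (the instance `a = 2`, `m = z`, with the second move of Route B and the
local-ring packaging); here the exponent `a` and the old-member monomial `m` are ARBITRARY (ring level, any commutative ring):

* §1 `cpole_eq`: `K = (x) + (t ℓ) + (tᵃ m)`; legality of both centres for `a ≥ 1` (`cpole_le_surface`, `cpole_le_line`).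
  **ROUTE A (RULE C3′, centre the surface component `V(x, t)`)**, `t`-chart (`x = g x′`, `t = g`):
  `K = (g) · ((x′) + (x′ + ℓ) + (gᵃ⁻¹ m))` and `(x′) + (x′ + ℓ) + (n) = (x′) + (ℓ) + (n)` (`csurfaceT_K`, `hosts_exchange`) —
  the hosts become TRANSVERSAL, **END IN ONE MOVE FOR EVERY `a`** (tri-2 (3)); `x`-chart `K = (g)` (`csurfaceX_K`).
  **ROUTE B (centre the non-END locus `λ = V(x, ℓ, t)`)**: `ℓ`-chart `K = (g) · ((x′) + (g t′) + (gᵃ⁻¹ t′ᵃ m))` (`clineL_K`;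
  for `a ≥ 2` this is `(g)·((x′) + (g t′))`, `clineL_K_two_le`), `x`-chart `(g)` (`clineX_K`), and the **RECURSION LAW** on the
  `t`-chart (`x = g x′`, `ℓ = g ℓ′`, `t = g`): `K = (g) · ((x′) + (x′ + g ℓ′) + (gᵃ⁻¹ m))` — the SAME pole with `a − 1` in place
  of `a` and the new exceptional `g` in place of `t` (`clineT_K`) ⇒ Route B costs `a` moves against Route A's one: the data
  point «component, never a sub-stratum» for X3 / RULE C3′ holds for every `a` (tri-2 (3)).
* §2 the images under the Rees chart maps of `Bl_{(x,t)}` and `Bl_{(x,ℓ,t)}` (`map_cpole_surface_*`, `map_cpole_line_*`).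

The local-ring END packaging of Route A is `isRsopPart_surfaceT_exchanged` of `…DepthPhaseCLinearTwoPlanePole` verbatim (the
exchanged family `(t, x/t, x/t + ℓ, …)` does not depend on `a`, `m`).  Fact-free; design evidence only.

## References
* The Stacks Project, Tags 0804, 0BIQ (affine blow-up algebras and their charts). [StacksProject]
* J. Kollár, *Lectures on Resolution of Singularities* (2007), (3.111) Step 3 (monomial bookkeeping). [Kollar2007]
-/

-- `Summit.<Summit>.<Sub>.Theorems` with `Sub = Summit` (single-conjunct summit, D-0017)
set_option linter.dupNamespace false

noncomputable section

open Literature.AlgebraicGeometry.Resolution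

namespace Summit.ResolutionOfSingularities.ResolutionOfSingularities.Theorems

universe u

namespace DepthPhaseC

/-- The common-trace pole `K = (x) + (x + t ℓ) + (tᵃ m)`. -/
local notation3 "Kc[" x "," l "," m "," t "," a "]" =>
  (Ideal.span {x} ⊔ Ideal.span {x + t * l} ⊔ Ideal.span {t ^ a * m})

/-! ## §1 The algebra of the moves -/

section Algebra

variable {A : Type u} [CommRing A]

/-- `K = (x) + (t ℓ) + (tᵃ m)`. [folklore] -/
theorem cpole_eq (x l m t : A) (a : ℕ) :
    Kc[x, l, m, t, a] = Ideal.span {x} ⊔ Ideal.span {t * l} ⊔ Ideal.span {t ^ a * m} := by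
  rw [sup_right_comm _ (Ideal.span {x + t * l}), sup_right_comm _ (Ideal.span {t * l})]
  refine sup_span_singleton_congr ?_
  rw [add_sub_cancel_right]
  exact Ideal.mem_sup_left (Ideal.mem_span_singleton_self x)

/-- **Legality of Route A (`ν = 1`)**: `K ≤ (x, t)` for `a ≥ 1`. [folklore] -/
theorem cpole_le_surface (x l m t : A) {a : ℕ} (ha : 1 ≤ a) : Kc[x, l, m, t, a] ≤ Ideal.span (Set.range ![x, t]) := by
  obtain ⟨b, rfl⟩ := Nat.exists_eq_add_of_le ha
  rw [CuspMember.span_range_vec2]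
  refine sup_le (sup_le le_sup_left ?_) ?_ <;> rw [Ideal.span_singleton_le_iff_mem]
  · exact Ideal.add_mem _ (Ideal.mem_sup_left (Ideal.mem_span_singleton_self x))
      (Ideal.mem_sup_right (Ideal.mul_mem_right _ _ (Ideal.mem_span_singleton_self t)))
  · exact Ideal.mem_sup_right (Ideal.mem_span_singleton.mpr ⟨t ^ b * m, by ring⟩)

/-- **Legality of Route B (`ν = 1`)**: `K ≤ (x, ℓ, t)` for `a ≥ 1`. [folklore] -/
theorem cpole_le_line (x l m t : A) {a : ℕ} (ha : 1 ≤ a) : Kc[x, l, m, t, a] ≤ Ideal.span (Set.range ![x, l, t]) := by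
  obtain ⟨b, rfl⟩ := Nat.exists_eq_add_of_le ha
  rw [CuspMember.span_range_vec3]
  refine sup_le (sup_le (le_sup_of_le_left le_sup_left) ?_) ?_ <;> rw [Ideal.span_singleton_le_iff_mem]
  · exact Ideal.add_mem _ (Ideal.mem_sup_left (Ideal.mem_sup_left (Ideal.mem_span_singleton_self x)))
      (Ideal.mem_sup_right (Ideal.mul_mem_right _ _ (Ideal.mem_span_singleton_self t)))
  · exact Ideal.mem_sup_right (Ideal.mem_span_singleton.mpr ⟨t ^ b * m, by ring⟩)

/-- **The host exchange** behind every END below: `(x′) + (x′ + ℓ) + (n) = (x′) + (ℓ) + (n)` — as IDEALS the two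
presentations agree (v11.3 Row Q / (F4): END is ideal equality with a monomial sum, not a generator-wise property). [folklore] -/
theorem hosts_exchange (x' l n : A) :
    Ideal.span {x'} ⊔ Ideal.span {x' + l} ⊔ Ideal.span {n} = Ideal.span {x'} ⊔ Ideal.span {l} ⊔ Ideal.span {n} := by
  rw [sup_right_comm _ (Ideal.span {x' + l}), sup_right_comm _ (Ideal.span {l})]
  refine sup_span_singleton_congr ?_
  rw [add_sub_cancel_right]
  exact Ideal.mem_sup_left (Ideal.mem_span_singleton_self x')

/-! ### Route A: the surface component `V(x, t)` — one move for every `a` -/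

/-- **Route A, `t`-chart** (`x = g x′`, `t = g`), `a ≥ 1`: `K = (g) · ((x′) + (x′ + ℓ) + (gᵃ⁻¹ m))`. [folklore] -/
theorem csurfaceT_K (x' l m g : A) (b : ℕ) :
    Kc[g * x', l, m, g, b + 1] = Ideal.span {g} * (Ideal.span {x'} ⊔ Ideal.span {x' + l} ⊔ Ideal.span {g ^ b * m}) := by
  rw [span_singleton_mul_sup₃, show g * x' + g * l = g * (x' + l) by ring,
    show g ^ (b + 1) * m = g * (g ^ b * m) by ring]

/-- **Route A END**: the controlled transform `(x′) + (x′ + ℓ) + (gᵃ⁻¹ m) = (x′) + (ℓ) + (gᵃ⁻¹ m)` — a monomial sum in the now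
TRANSVERSAL hosts `V(x′)`, `V(x′ + ℓ)` and the members (letters of `g`, `m`). [cite: Kollar2007, (3.111) Step 3] -/
theorem csurfaceT_end (x' l m g : A) (b : ℕ) :
    Ideal.span {x'} ⊔ Ideal.span {x' + l} ⊔ Ideal.span {g ^ b * m} =
      Ideal.span {x'} ⊔ Ideal.span {l} ⊔ Ideal.span {g ^ b * m} :=
  hosts_exchange x' l _

/-- **Route A, `x`-chart** (`x = g`, `t = g t′`), `a ≥ 1`: `K = (g)`. [folklore] -/
theorem csurfaceX_K (l m t' g : A) (b : ℕ) : Kc[g, l, m, g * t', b + 1] = Ideal.span {g} := by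
  refine le_antisymm (sup_le (sup_le le_rfl ?_) ?_) (le_sup_of_le_left le_sup_left) <;>
    rw [Ideal.span_singleton_le_iff_mem]
  · exact Ideal.mem_span_singleton.mpr ⟨1 + t' * l, by ring⟩
  · exact Ideal.mem_span_singleton.mpr ⟨(g * t') ^ b * t' * m, by ring⟩

/-! ### Route B: the non-END locus `λ = V(x, ℓ, t)` — the recursion `a ↦ a − 1` -/

/-- **Route B, `ℓ`-chart** (`x = g x′`, `ℓ = g`, `t = g t′`), `a ≥ 1`: `K = (g) · ((x′) + (g t′) + (gᵃ⁻¹ t′ᵃ m))` — a monomial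
sum in the chart letters (`END`). [folklore] -/
theorem clineL_K (x' m t' g : A) (b : ℕ) :
    Kc[g * x', g, m, g * t', b + 1] =
      Ideal.span {g} * (Ideal.span {x'} ⊔ Ideal.span {g * t'} ⊔ Ideal.span {g ^ b * t' ^ (b + 1) * m}) := by
  rw [span_singleton_mul_sup₃, show (g * t') ^ (b + 1) * m = g * (g ^ b * t' ^ (b + 1) * m) by ring,
    sup_right_comm _ (Ideal.span {g * x' + g * t' * g}), sup_right_comm _ (Ideal.span {g * (g * t')})]
  refine sup_span_singleton_congr ?_
  rw [show g * x' + g * t' * g - g * (g * t') = g * x' by ring]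
  exact Ideal.mem_sup_left (Ideal.mem_span_singleton_self _)

/-- For `a ≥ 2` the third summand of the `ℓ`-chart is swallowed: `(x′) + (g t′) + (gᵃ⁻¹ t′ᵃ m) = (x′) + (g t′)`. [folklore] -/
theorem clineL_K_two_le (x' m t' g : A) (b : ℕ) :
    Ideal.span {x'} ⊔ Ideal.span {g * t'} ⊔ Ideal.span {g ^ (b + 1) * t' ^ (b + 2) * m} =
      Ideal.span {x'} ⊔ Ideal.span {g * t'} :=
  sup_eq_left.mpr (le_sup_of_le_right (Ideal.span_singleton_le_span_singleton.mpr
    ⟨g ^ b * t' ^ (b + 1) * m, by ring⟩))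

/-- **Route B, `x`-chart** (`x = g`, `ℓ = g ℓ′`, `t = g t′`), `a ≥ 1`: `K = (g)`. [folklore] -/
theorem clineX_K (l' m t' g : A) (b : ℕ) : Kc[g, g * l', m, g * t', b + 1] = Ideal.span {g} := by
  refine le_antisymm (sup_le (sup_le le_rfl ?_) ?_) (le_sup_of_le_left le_sup_left) <;>
    rw [Ideal.span_singleton_le_iff_mem]
  · exact Ideal.mem_span_singleton.mpr ⟨1 + t' * g * l', by ring⟩
  · exact Ideal.mem_span_singleton.mpr ⟨(g * t') ^ b * t' * m, by ring⟩

/-- **Route B, `t`-chart — the RECURSION LAW** (`x = g x′`, `ℓ = g ℓ′`, `t = g`), `a ≥ 1`: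
`K = (g) · ((x′) + (x′ + g ℓ′) + (gᵃ⁻¹ m))`, the same common-trace pole with exponent `a − 1` and `g` for `t`. [folklore] -/
theorem clineT_K (x' l' m g : A) (b : ℕ) : Kc[g * x', g * l', m, g, b + 1] = Ideal.span {g} * Kc[x', l', m, g, b] := by
  rw [span_singleton_mul_sup₃, show g * x' + g * (g * l') = g * (x' + g * l') by ring,
    show g ^ (b + 1) * m = g * (g ^ b * m) by ring]

/-- At the bottom of the recursion (`a = 0`) the pole is the unit ideal as soon as `m` is a unit — e.g. off the old members.
[folklore] -/
theorem cpole_zero_eq_top_of_isUnit (x l t : A) {m : A} (hm : IsUnit m) : Kc[x, l, m, t, 0] = ⊤ := by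
  rw [pow_zero, one_mul, Ideal.span_singleton_eq_top.mpr hm, sup_top_eq]

end Algebra

/-! ## §2 The images on the Rees charts -/

section Charts

variable {R : Type u} [CommRing R] (x l m t : R)

local notation3 "c₂" => (![x, t] : Fin 2 → R)
local notation3 "c₃" => (![x, l, t] : Fin 3 → R)

set_option maxHeartbeats 400000 in
-- instance-path defeq through `HomogeneousLocalization`'s standalone `Pow`/`Mul` (as in p508825)
/-- **Route A, `t`-chart image** (`a = b + 1`): `K · B_t = (t) · ((x/t) + (x/t + ℓ) + (tᵇ m))`. [cite: StacksProject, Tag 0804] -/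
theorem map_cpole_surface_one (b : ℕ) :
    (Kc[x, l, m, t, b + 1]).map (chartBase c₂ 1) = Ideal.span {chartBase c₂ 1 t} *
      (Ideal.span {chartGen c₂ 1 0} ⊔ Ideal.span {chartGen c₂ 1 0 + chartBase c₂ 1 l} ⊔
        Ideal.span {chartBase c₂ 1 t ^ b * chartBase c₂ 1 m}) := by
  have cb : chartBase c₂ 1 x = chartBase c₂ 1 t * chartGen c₂ 1 0 := reesChartBase_apply_eq_mul_chartGen c₂ 1 0
  rw [map_sup₃, map_add, map_mul, map_mul, map_pow, cb]
  exact csurfaceT_K _ _ _ _ b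

set_option maxHeartbeats 400000 in
-- instance-path defeq through `HomogeneousLocalization`'s standalone `Pow`/`Mul` (as in p508825)
/-- **Route A, `x`-chart image** (`a = b + 1`): `K · B_x = (x)`. [cite: StacksProject, Tag 0804] -/
theorem map_cpole_surface_zero (b : ℕ) :
    (Kc[x, l, m, t, b + 1]).map (chartBase c₂ 0) = Ideal.span {chartBase c₂ 0 x} := by
  have cb : chartBase c₂ 0 t = chartBase c₂ 0 x * chartGen c₂ 0 1 := reesChartBase_apply_eq_mul_chartGen c₂ 0 1
  rw [map_sup₃, map_add, map_mul, map_mul, map_pow, cb]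
  exact csurfaceX_K _ _ _ _ b

set_option maxHeartbeats 400000 in
-- instance-path defeq through `HomogeneousLocalization`'s standalone `Pow`/`Mul` (as in p508825)
/-- **Route B, `ℓ`-chart image** (`a = b + 1`). [cite: StacksProject, Tag 0804] -/
theorem map_cpole_line_one (b : ℕ) :
    (Kc[x, l, m, t, b + 1]).map (chartBase c₃ 1) = Ideal.span {chartBase c₃ 1 l} *
      (Ideal.span {chartGen c₃ 1 0} ⊔ Ideal.span {chartBase c₃ 1 l * chartGen c₃ 1 2} ⊔
        Ideal.span {chartBase c₃ 1 l ^ b * chartGen c₃ 1 2 ^ (b + 1) * chartBase c₃ 1 m}) := by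
  have cbx : chartBase c₃ 1 x = chartBase c₃ 1 l * chartGen c₃ 1 0 := reesChartBase_apply_eq_mul_chartGen c₃ 1 0
  have cbt : chartBase c₃ 1 t = chartBase c₃ 1 l * chartGen c₃ 1 2 := reesChartBase_apply_eq_mul_chartGen c₃ 1 2
  rw [map_sup₃, map_add, map_mul, map_mul, map_pow, cbx, cbt]
  exact clineL_K _ _ _ _ b

set_option maxHeartbeats 400000 in
-- instance-path defeq through `HomogeneousLocalization`'s standalone `Pow`/`Mul` (as in p508825)
/-- **Route B, `x`-chart image** (`a = b + 1`): `K · B_x = (x)`. [cite: StacksProject, Tag 0804] -/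
theorem map_cpole_line_zero (b : ℕ) :
    (Kc[x, l, m, t, b + 1]).map (chartBase c₃ 0) = Ideal.span {chartBase c₃ 0 x} := by
  have cbl : chartBase c₃ 0 l = chartBase c₃ 0 x * chartGen c₃ 0 1 := reesChartBase_apply_eq_mul_chartGen c₃ 0 1
  have cbt : chartBase c₃ 0 t = chartBase c₃ 0 x * chartGen c₃ 0 2 := reesChartBase_apply_eq_mul_chartGen c₃ 0 2
  rw [map_sup₃, map_add, map_mul, map_mul, map_pow, cbl, cbt]
  exact clineX_K _ _ _ _ b

set_option maxHeartbeats 400000 in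
-- instance-path defeq through `HomogeneousLocalization`'s standalone `Pow`/`Mul` (as in p508825)
/-- **Route B, `t`-chart image — the recursion law** (`a = b + 1`): `K · B_t = (t) · K(x/t, ℓ/t, m, t; b)`.
[cite: StacksProject, Tag 0804] -/
theorem map_cpole_line_two (b : ℕ) :
    (Kc[x, l, m, t, b + 1]).map (chartBase c₃ 2) =
      Ideal.span {chartBase c₃ 2 t} * Kc[chartGen c₃ 2 0, chartGen c₃ 2 1, chartBase c₃ 2 m, chartBase c₃ 2 t, b] := by
  have cbx : chartBase c₃ 2 x = chartBase c₃ 2 t * chartGen c₃ 2 0 := reesChartBase_apply_eq_mul_chartGen c₃ 2 0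
  have cbl : chartBase c₃ 2 l = chartBase c₃ 2 t * chartGen c₃ 2 1 := reesChartBase_apply_eq_mul_chartGen c₃ 2 1
  rw [map_sup₃, map_add, map_mul, map_mul, map_pow, cbx, cbl]
  exact clineT_K _ _ _ _ b

end Charts

end DepthPhaseC

end Summit.ResolutionOfSingularities.ResolutionOfSingularities.Theorems

end
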